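import Summits.AtomisticToContinuum.HydrodynamicLimit.Theses.JParityClosure
import Summits.AtomisticToContinuum.HydrodynamicLimit.Theorems.JParityClosureAssemblyReduction
import Summits.AtomisticToContinuum.HydrodynamicLimit.Theorems.DensityCap.Negative.DensityCapFalseOfDenseExcursionAbovePacking
import Literature.Analysis.FluidPDE.DissipativeMVEuler

/-!
# Disproof of `ParityBandClosure` (crux 7, stmt-AtomisticToContinuum-17608, route JParityClosure) — findings

Standing crux disprover `refuter-cdisprove-stmt-AtomisticToContinuum-17608-0`, cycle 1 (2026-08-17).

Crux: `ParityBandClosure := OddContactSymmetry → EvenStressEnskog → RateFloor → LocalSecondLaw → DensityCap →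
_root_.HydrodynamicLimit` — the route's CLOSURE STEP: the five physics cruxes imply the packing-guarded summit
conjunct (`_root_.HydrodynamicLimit`, re-typed p126922, `= HydroLimitInBandDim 3`).

## Verdict of cycle 1: NO KILL — and WHY it resists (kernel-checked, §1)

`not_parityBandClosure_iff`: **`¬ ParityBandClosure ↔ (OddContactSymmetry ∧ EvenStressEnskog ∧ RateFloor ∧
LocalSecondLaw ∧ DensityCap) ∧ ¬ _root_.HydrodynamicLimit`.** A refutation of this crux must therefore (a) PROVE all
five open physics cruxes of the route AND (b) REFUTE the audited summit conjunct. Neither half is within reach of any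
seat: (a) is the route's whole programme; (b) is the open problem from the negative side (failure of local
equilibrium for deterministic hard spheres at arbitrarily small reduced density, inside the packing guard). The crux
is sandwiched `Statement → ParityBandClosure` (`parityBandClosure_of_statement`) and is exactly as refutable as the
Statement is GIVEN the five cruxes — no more.

## Index

* §1 ANATOMY — `not_parityBandClosure_iff`, `parityBandClosure_of_statement`, the five VACUITY CHANNELS
  `parityBandClosure_of_not_<H>` (a refutation of ANY hypothesis closes this item trivially and kills the route),
  `parityBandClosure_iff_parityInBand` (modulo the two open supports the crux IS the typed glue `ParityInBand`;
  re-exported from the tree's `JParityClosureAssemblyReduction`).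
* §2 LOAD-BEARING ANALYSIS of the five OUTER hypotheses — for each `H`, `ParityBandClosureWithout<H>` (the crux
  with `H` dropped) satisfies `Statement → Without<H> → ParityBandClosure` and
  `¬ Without<H> ↔ (other four) ∧ ¬ Statement`: **a `_false_without_<H>` theorem is EQUIVALENT to refuting the
  summit conjunct given the other four cruxes** (`not_statement_of_not_without<H>`). No such lemma can be landed by
  a disprover; "which hypotheses the proof must use" is undecidable from the negative side for a closed-`Prop`
  implication. (Contrast the sibling closure crux `HydroLimitInBand` 9133, whose INNER, universally quantified
  hypotheses — mass / momentum / energy equations, smoothness, tie, guard, `0 < σ` — ARE load-bearing by explicit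
  witnesses: `Theorems/HydroLimitInBand/Negative/LoadBearing*.lean`, `SigmaZero.lean`. Those transfer verbatim to
  the CONCLUSION of this crux; see the caveat on stale modules below before importing `LoadBearingII`.)
* §3 THE ONE LIVE VACUITY CHANNEL WITH A NAMED TRIGGER — `parityBandClosure_of_denseExcursionAbovePacking`,
  `parityBandClosure_of_not_packingBandAt`: hypothesis `DensityCap` (13082) is filed UNGUARDED, and the tree proves
  `DensityCap → PackingBandAt (81/π)` (`DensityCapNegative.packingBandAt_of_densityCap`): a tied classical hs-Euler
  solution out-compressing the sure packing level `ρσ³ ≤ 81/π` at arbitrarily small `σ` (the open PDE implosion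
  question `DenseExcursionAbovePacking`, MerleEtAl2022-type profiles through the typed equation of state) makes
  `DensityCap` FALSE and hence THIS crux TRUE FOR THE WRONG REASON (item closes, route dies). Planner note: filing
  `DensityCap` with the conjunct's packing guard (the DensityCap disprover's §8 repair) closes this channel; the
  guarded cap is all `ParityInBand` step (ii) consumes.
* §4 NATURAL STRENGTHENINGS — `ParityBandClosureUnguarded` (conclusion = the unguarded Literature conjecture):
  implies the crux (`parityBandClosure_of_unguarded`), and `¬ Unguarded ↔ X ∧ ¬ Literature.HydrodynamicLimit` —
  still needs X; with §3, `X → (Unguarded → PackingBandAt (81/π))`-type consequences are the implosion exposure of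
  the OLD conjunct, which the re-type removed from the crux as filed. Uniform-threshold / all-`t` strengthenings:
  same shape, same obstruction (prose).
* §5 ENGINE HAZARDS for the intended proof (BF18 relative energy), as cheap checked facts for the provers:
  `not_isEntropyCutoff_id` — the in-tree engine `IsDissipativeMVSolution.entropy` quantifies over BOUNDED monotone
  continuous cut-offs `Z`; the identity (the only "cut-off" `LocalSecondLaw` speaks about) is not one;
  `total_entropy_balance_not_renormalised` — a two-cell toy: total entropy conserved while a bounded monotone
  renormalisation strictly DECREASES (heat exchange between the two atoms of a Young measure), i.e. the `Z = id`
  inequality does not dominate the renormalised family. These document the planner's G2 hazard; they do not bear on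
  the truth of the crux. LITERATURE (§5 note, read this session): BrezinaFeireisl2018Revisited Def. 2.1 / Thm 2.5
  (arXiv:1710.10751) needs ONLY the total (`Z = id`) entropy balance for weak(mv)–strong uniqueness (polytropic
  caloric law) — G2 is a hazard of the VENDORED engine (Def. 2.9 form), not of the method. G1 (energy): the energy third of the Statement needs only a ONE-SIDED lower bound plus the
  exact total energy (`Theorems/JParityClosureAssemblyEnergyOneSided.lean`, `energyConjunct_of_lower`), and the
  density third is exactly `DensityCap` (`uniformL1_of_densityCap`); the crux's genuine content is the MOMENTUM third
  + the lower energy bound, i.e. the identification of the limit stress.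
* §6 JUNK AUDIT of the shared `let`-objects (prose; all consistent — no orientation / normalisation / log-of-zero /
  empty-quantifier kill): see the docstring `junk_audit`.
* §7 `-- Targets`: none (payload.stuck_stubs = [], no line picked yet).
* §8 INFRASTRUCTURE HAZARD found while attacking (reported in NOTES/evidence): the farm serves STALE `.olean`s for
  modules whose SOURCE no longer compiles after the Statement re-type p126922 — e.g.
  `Theorems/DensityCap/Negative/ConjunctPacking.lean` (a verbatim copy fails: `h a₀ …` on the now-`∃ η₀`-headed
  conjunct; `DiluteSelfConsistency` unknown) still IMPORTS and exposes
  `packingBandAt_of_hydrodynamicLimit : HydrodynamicLimit → PackingBandAt (81/π)` and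
  `JParityClosureDensityCap.densityCap_of_hydrodynamicLimit : HydrodynamicLimit → DensityCap` with `HydrodynamicLimit`
  now denoting the GUARDED conjunct — statements that were proved for the OLD unguarded abbrev and are NOT theorems
  for the new one. Likewise `HydroLimitInBandNegative.hydroLimitInBandWithoutGuard_iff : … ↔ _root_.HydrodynamicLimit`
  (LoadBearingII, pre-retype). THIS FILE IMPORTS NONE OF THEM (its three Summit imports were re-elaborated from
  source this session: `JParityClosureAssemblyReduction` is post-retype; `DensityCapFalseOfDenseExcursionAbovePacking`,
  `Packing`, `PolynomialCompression/Negative/Ladder` compile verbatim today). Provers: do not build on the stale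
  lemmas until the tree is rebuilt from source.

Nothing in this file is sorried.
-/

noncomputable section

open MeasureTheory Filter Set Topology
open scoped ENNReal

namespace Summit.AtomisticToContinuum.HydrodynamicLimit.Cruxes.ParityBandClosure.Disproof

open Summit.AtomisticToContinuum.HydrodynamicLimit.Theses.JParityClosure
open Summit.AtomisticToContinuum.HydrodynamicLimit.Theorems
open Summit.AtomisticToContinuum.HydrodynamicLimit.Theorems.DensityCapNegative
  (PackingBandAt DenseExcursionAbovePacking densityCap_false_of_denseExcursionAbovePacking
    not_densityCap_of_not_packingBandAt packingBandAt_of_densityCap)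

/-! ## §1 Anatomy: what a kill must contain -/

/-- The conjunction of the five physics cruxes of the route (the `X` of the thesis `X → Statement`). -/
def X : Prop :=
  OddContactSymmetry ∧ EvenStressEnskog ∧ RateFloor ∧ LocalSecondLaw ∧ DensityCap

/-- The crux is `X → Statement` (currying; the tree's `jParityClosure_assembly_iff_parityBandClosure`). -/
theorem parityBandClosure_iff_imp : ParityBandClosure ↔ (X → _root_.HydrodynamicLimit) :=
  jParityClosure_assembly_iff_parityBandClosure.symm

/-- **WHY IT RESISTS.** A refutation of the closure crux is EXACTLY a proof of the five physics cruxes together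
with a refutation of the summit conjunct. -/
theorem not_parityBandClosure_iff :
    ¬ ParityBandClosure ↔ (OddContactSymmetry ∧ EvenStressEnskog ∧ RateFloor ∧ LocalSecondLaw ∧ DensityCap) ∧
      ¬ _root_.HydrodynamicLimit := by
  rw [parityBandClosure_iff_imp, Classical.not_imp]
  rfl

/-- The crux is implied by its own conclusion: it cannot be refuted without refuting the Statement. -/
theorem parityBandClosure_of_statement (h : _root_.HydrodynamicLimit) : ParityBandClosure :=
  fun _ _ _ _ _ => h

/-- Contrapositive packaging: any refutation of the crux refutes the summit conjunct. -/
theorem not_statement_of_not_parityBandClosure (h : ¬ ParityBandClosure) : ¬ _root_.HydrodynamicLimit :=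
  fun hS => h (parityBandClosure_of_statement hS)

/-- VACUITY CHANNEL 1: a refutation of `OddContactSymmetry` (17722) proves this crux (ex falso). -/
theorem parityBandClosure_of_not_oddContactSymmetry (h : ¬ OddContactSymmetry) : ParityBandClosure :=
  fun h₂ => absurd h₂ h

/-- VACUITY CHANNEL 2: a refutation of `EvenStressEnskog` (13079) proves this crux. -/
theorem parityBandClosure_of_not_evenStressEnskog (h : ¬ EvenStressEnskog) : ParityBandClosure :=
  fun _ h₃ => absurd h₃ h

/-- VACUITY CHANNEL 3: a refutation of `RateFloor` (13080) proves this crux. -/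
theorem parityBandClosure_of_not_rateFloor (h : ¬ RateFloor) : ParityBandClosure :=
  fun _ _ h₄ => absurd h₄ h

/-- VACUITY CHANNEL 4: a refutation of `LocalSecondLaw` (13081) proves this crux. -/
theorem parityBandClosure_of_not_localSecondLaw (h : ¬ LocalSecondLaw) : ParityBandClosure :=
  fun _ _ _ h₅ => absurd h₅ h

/-- VACUITY CHANNEL 5: a refutation of `DensityCap` (13082) proves this crux. -/
theorem parityBandClosure_of_not_densityCap (h : ¬ DensityCap) : ParityBandClosure :=
  fun _ _ _ _ h₆ => absurd h₆ h

/-- Summary of the channels: the crux is PROVABLE as soon as `X` is refutable OR the Statement is provable, and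
REFUTABLE only when `X` is provable AND the Statement refutable. -/
theorem parityBandClosure_of_not_X_or_statement (h : ¬ X ∨ _root_.HydrodynamicLimit) : ParityBandClosure :=
  parityBandClosure_iff_imp.2 fun hX => h.elim (fun hnX => absurd hX hnX) id

/-- Modulo the two OPEN supports `CollisionTightness` (13085) and `KineticEnergyTails` (13087) the crux IS the typed
glue `ParityInBand` (13088) (the four other supports are proved in the tree). So every prover verdict on 13088
("misstated": G1 energy tails, G2 renormalised entropy) applies to this crux a fortiori, and conversely a proof of
this crux proves 13088 outright. -/
theorem parityBandClosure_iff_parityInBand (hCT : CollisionTightness) (hKET : KineticEnergyTails) :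
    ParityBandClosure ↔ ParityInBand := by
  constructor
  · intro h h₂ h₃ h₄ h₅ h₆ _ _ _ _ _ _
    have hS : _root_.HydrodynamicLimit := h h₂ h₃ h₄ h₅ h₆
    exact hS
  · intro hPIB
    exact jParityClosure_assembly_iff_parityBandClosure.1
      (jParityClosure_assembly_of_parityInBand hPIB hCT hKET)

/-- Unconditionally, the crux implies the glue item (more hypotheses, same conclusion). -/
theorem parityInBand_of_parityBandClosure (h : ParityBandClosure) : ParityInBand :=
  fun h₂ h₃ h₄ h₅ h₆ _ _ _ _ _ _ => h h₂ h₃ h₄ h₅ h₆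

/-! ## §2 Load-bearing analysis of the five outer hypotheses: summit-hard in both directions

For a closed-`Prop` implication `H₁ → … → H₅ → S`, dropping `Hᵢ` gives a statement BETWEEN `S` and the crux.
So "`_false_without_Hᵢ`" is `¬S` given the other four, and "`Hᵢ` unnecessary" is a proof of the crux from four
cruxes — both are the open problem. We record the sandwich once per hypothesis so that no later seat re-derives it. -/

/-- The crux with `OddContactSymmetry` dropped. -/
def ParityBandClosureWithoutOdd : Prop :=
  EvenStressEnskog → RateFloor → LocalSecondLaw → DensityCap → _root_.HydrodynamicLimit

/-- The crux with `EvenStressEnskog` dropped. -/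
def ParityBandClosureWithoutEven : Prop :=
  OddContactSymmetry → RateFloor → LocalSecondLaw → DensityCap → _root_.HydrodynamicLimit

/-- The crux with `RateFloor` dropped. -/
def ParityBandClosureWithoutRate : Prop :=
  OddContactSymmetry → EvenStressEnskog → LocalSecondLaw → DensityCap → _root_.HydrodynamicLimit

/-- The crux with `LocalSecondLaw` dropped. -/
def ParityBandClosureWithoutLSL : Prop :=
  OddContactSymmetry → EvenStressEnskog → RateFloor → DensityCap → _root_.HydrodynamicLimit

/-- The crux with `DensityCap` dropped. -/
def ParityBandClosureWithoutDC : Prop :=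
  OddContactSymmetry → EvenStressEnskog → RateFloor → LocalSecondLaw → _root_.HydrodynamicLimit

/-- Sandwich, parity hypothesis: `Statement → WithoutOdd → ParityBandClosure`. -/
theorem withoutOdd_sandwich :
    (_root_.HydrodynamicLimit → ParityBandClosureWithoutOdd) ∧ (ParityBandClosureWithoutOdd → ParityBandClosure) :=
  ⟨fun h _ _ _ _ => h, fun h _ h₃ h₄ h₅ h₆ => h h₃ h₄ h₅ h₆⟩

/-- `¬ WithoutOdd ↔ (the other four) ∧ ¬ Statement`: a `_false_without_Odd` lemma is a refutation of the summit
conjunct from `EvenStressEnskog ∧ RateFloor ∧ LocalSecondLaw ∧ DensityCap`. -/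
theorem not_withoutOdd_iff : ¬ ParityBandClosureWithoutOdd ↔
    (EvenStressEnskog ∧ RateFloor ∧ LocalSecondLaw ∧ DensityCap) ∧ ¬ _root_.HydrodynamicLimit := by
  unfold ParityBandClosureWithoutOdd
  constructor
  · intro h
    by_contra hc
    exact h fun h₃ h₄ h₅ h₆ => by_contra fun hS => hc ⟨⟨h₃, h₄, h₅, h₆⟩, hS⟩
  · rintro ⟨⟨h₃, h₄, h₅, h₆⟩, hS⟩ h
    exact hS (h h₃ h₄ h₅ h₆)

/-- Sandwich, configurational hypothesis. -/
theorem withoutEven_sandwich :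
    (_root_.HydrodynamicLimit → ParityBandClosureWithoutEven) ∧ (ParityBandClosureWithoutEven → ParityBandClosure) :=
  ⟨fun h _ _ _ _ => h, fun h h₂ _ h₄ h₅ h₆ => h h₂ h₄ h₅ h₆⟩

/-- `¬ WithoutEven ↔ (the other four) ∧ ¬ Statement`. -/
theorem not_withoutEven_iff : ¬ ParityBandClosureWithoutEven ↔
    (OddContactSymmetry ∧ RateFloor ∧ LocalSecondLaw ∧ DensityCap) ∧ ¬ _root_.HydrodynamicLimit := by
  unfold ParityBandClosureWithoutEven
  constructor
  · intro h
    by_contra hc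
    exact h fun h₂ h₄ h₅ h₆ => by_contra fun hS => hc ⟨⟨h₂, h₄, h₅, h₆⟩, hS⟩
  · rintro ⟨⟨h₂, h₄, h₅, h₆⟩, hS⟩ h
    exact hS (h h₂ h₄ h₅ h₆)

/-- Sandwich, rate floor. -/
theorem withoutRate_sandwich :
    (_root_.HydrodynamicLimit → ParityBandClosureWithoutRate) ∧ (ParityBandClosureWithoutRate → ParityBandClosure) :=
  ⟨fun h _ _ _ _ => h, fun h h₂ h₃ _ h₅ h₆ => h h₂ h₃ h₅ h₆⟩

/-- `¬ WithoutRate ↔ (the other four) ∧ ¬ Statement`. -/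
theorem not_withoutRate_iff : ¬ ParityBandClosureWithoutRate ↔
    (OddContactSymmetry ∧ EvenStressEnskog ∧ LocalSecondLaw ∧ DensityCap) ∧ ¬ _root_.HydrodynamicLimit := by
  unfold ParityBandClosureWithoutRate
  constructor
  · intro h
    by_contra hc
    exact h fun h₂ h₃ h₅ h₆ => by_contra fun hS => hc ⟨⟨h₂, h₃, h₅, h₆⟩, hS⟩
  · rintro ⟨⟨h₂, h₃, h₅, h₆⟩, hS⟩ h
    exact hS (h h₂ h₃ h₅ h₆)

/-- Sandwich, local second law. -/
theorem withoutLSL_sandwich :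
    (_root_.HydrodynamicLimit → ParityBandClosureWithoutLSL) ∧ (ParityBandClosureWithoutLSL → ParityBandClosure) :=
  ⟨fun h _ _ _ _ => h, fun h h₂ h₃ h₄ _ h₆ => h h₂ h₃ h₄ h₆⟩

/-- `¬ WithoutLSL ↔ (the other four) ∧ ¬ Statement`. -/
theorem not_withoutLSL_iff : ¬ ParityBandClosureWithoutLSL ↔
    (OddContactSymmetry ∧ EvenStressEnskog ∧ RateFloor ∧ DensityCap) ∧ ¬ _root_.HydrodynamicLimit := by
  unfold ParityBandClosureWithoutLSL
  constructor
  · intro h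
    by_contra hc
    exact h fun h₂ h₃ h₄ h₆ => by_contra fun hS => hc ⟨⟨h₂, h₃, h₄, h₆⟩, hS⟩
  · rintro ⟨⟨h₂, h₃, h₄, h₆⟩, hS⟩ h
    exact hS (h h₂ h₃ h₄ h₆)

/-- Sandwich, density cap. -/
theorem withoutDC_sandwich :
    (_root_.HydrodynamicLimit → ParityBandClosureWithoutDC) ∧ (ParityBandClosureWithoutDC → ParityBandClosure) :=
  ⟨fun h _ _ _ _ => h, fun h h₂ h₃ h₄ h₅ _ => h h₂ h₃ h₄ h₅⟩

/-- `¬ WithoutDC ↔ (the other four) ∧ ¬ Statement`. -/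
theorem not_withoutDC_iff : ¬ ParityBandClosureWithoutDC ↔
    (OddContactSymmetry ∧ EvenStressEnskog ∧ RateFloor ∧ LocalSecondLaw) ∧ ¬ _root_.HydrodynamicLimit := by
  unfold ParityBandClosureWithoutDC
  constructor
  · intro h
    by_contra hc
    exact h fun h₂ h₃ h₄ h₅ => by_contra fun hS => hc ⟨⟨h₂, h₃, h₄, h₅⟩, hS⟩
  · rintro ⟨⟨h₂, h₃, h₄, h₅⟩, hS⟩ h
    exact hS (h h₂ h₃ h₄ h₅)

/-- Upshot for the audit trail: a `_false_without_<H>` lemma for ANY of the five outer hypotheses refutes the summit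
conjunct. (Stated for `DensityCap`; the other four are the `not_without*_iff` above.) -/
theorem not_statement_of_not_withoutDC (h : ¬ ParityBandClosureWithoutDC) : ¬ _root_.HydrodynamicLimit :=
  (not_withoutDC_iff.1 h).2

/-! ## §3 The live vacuity channel with a named trigger: the UNGUARDED density cap

`DensityCap` (13082) carries no packing guard, and the tree proves that it forces the sure packing band
`ρ_t(x) σ³ ≤ 81/π` on every tied classical hs-Euler solution at small `σ` (`packingBandAt_of_densityCap`,
`Theorems/DensityCap/Negative/DensityCapFalseOfDenseExcursionAbovePacking.lean`, re-elaborated from source this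
session). Hence the named hypothesis `DenseExcursionAbovePacking` (an implosion of the TYPED equation of state past
`81/π` from tied local-Gibbs data at arbitrarily small `σ`; open, PDE-only, no particle dynamics) would make this crux
TRUE by ex falso while killing the route. -/

/-- **`DenseExcursionAbovePacking → ParityBandClosure`** (vacuously, through `¬ DensityCap`). -/
theorem parityBandClosure_of_denseExcursionAbovePacking (hH : DenseExcursionAbovePacking) : ParityBandClosure :=
  parityBandClosure_of_not_densityCap (densityCap_false_of_denseExcursionAbovePacking hH)

/-- The same through the packing band: ANY failure of `PackingBandAt (81/π)` (some profiles, arbitrarily small `σ`,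
one tied classical solution, one flow family, one point above the sure packing level) proves this crux vacuously. -/
theorem parityBandClosure_of_not_packingBandAt (h : ¬ PackingBandAt (81 / Real.pi)) : ParityBandClosure :=
  parityBandClosure_of_not_densityCap (not_densityCap_of_not_packingBandAt h)

/-- Dichotomy recorded for the planner: EITHER the packing band at level `81/π` holds for all profiles at small `σ`
(a `DiluteSelfConsistency`-type PDE statement nobody has proved for the typed pressure law), OR this crux is
trivially true and the route is dead through `DensityCap`. The guarded repair of 13082 removes the second horn. -/
theorem packingBand_or_vacuous : PackingBandAt (81 / Real.pi) ∨ ParityBandClosure := by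
  by_cases h : PackingBandAt (81 / Real.pi)
  · exact Or.inl h
  · exact Or.inr (parityBandClosure_of_not_packingBandAt h)

/-- In the non-vacuous world (all five cruxes true) the packing band is a THEOREM of the hypotheses alone — the
conclusion is not needed for it; so inside `X` the guard of the Statement is automatically available at level
`81/π` (not at the Statement's own `η₀`, which the proof must still produce from the items' thresholds). -/
theorem packingBandAt_of_X (hX : X) : PackingBandAt (81 / Real.pi) :=
  packingBandAt_of_densityCap hX.2.2.2.2

/-! ## §4 Natural strengthenings -/

/-- STRENGTHENING 1: the same five cruxes implying the UNGUARDED Literature conjecture (the pre-retype conjunct). -/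
def ParityBandClosureUnguarded : Prop :=
  OddContactSymmetry → EvenStressEnskog → RateFloor → LocalSecondLaw → DensityCap →
    Literature.MathematicalPhysics.KineticTheory.HydrodynamicLimit

/-- The unguarded strengthening implies the crux (`HydrodynamicLimit.of_unguarded`). -/
theorem parityBandClosure_of_unguarded (h : ParityBandClosureUnguarded) : ParityBandClosure :=
  fun h₂ h₃ h₄ h₅ h₆ => HydrodynamicLimit.of_unguarded (h h₂ h₃ h₄ h₅ h₆)

/-- … and is refutable only through `X ∧ ¬ (unguarded conjecture)`: the implosion exposure of the OLD conjunct
(audit §3.1, routes ImplosionLoophole / ImplosionDichotomy) would bite the strengthening ONLY together with a proof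
of the five cruxes — and by §3 a proof of `DensityCap` already FORBIDS the implosion past `81/π`. So the natural
implosion witness against the unguarded form is killed by hypothesis `DensityCap` itself: no cheap refutation of the
strengthening either. -/
theorem not_unguarded_iff : ¬ ParityBandClosureUnguarded ↔
    X ∧ ¬ Literature.MathematicalPhysics.KineticTheory.HydrodynamicLimit := by
  unfold ParityBandClosureUnguarded X
  constructor
  · intro h
    by_contra hc
    exact h fun h₂ h₃ h₄ h₅ h₆ => by_contra fun hS => hc ⟨⟨h₂, h₃, h₄, h₅, h₆⟩, hS⟩
  · rintro ⟨⟨h₂, h₃, h₄, h₅, h₆⟩, hS⟩ h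
    exact hS (h h₂ h₃ h₄ h₅ h₆)

/-- STRENGTHENING 2 (prose): conclusion at ALL `t ≥ 0` (past the first shock) or with a profile-UNIFORM `σ₀` — same
closed-`Prop` shape `X → S'`, refutable only via `X ∧ ¬S'`; `¬S'` past the shock is again the open problem (no
post-shock statement about deterministic spheres is provable in either direction). Not pursued. -/
theorem strengthening_shape (S' : Prop) :
    ¬ (OddContactSymmetry → EvenStressEnskog → RateFloor → LocalSecondLaw → DensityCap → S') ↔ X ∧ ¬ S' := by
  unfold X
  constructor
  · intro h
    by_contra hc
    exact h fun h₂ h₃ h₄ h₅ h₆ => by_contra fun hS => hc ⟨⟨h₂, h₃, h₄, h₅, h₆⟩, hS⟩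
  · rintro ⟨⟨h₂, h₃, h₄, h₅, h₆⟩, hS⟩ h
    exact hS (h h₂ h₃ h₄ h₅ h₆)

/-! ## §5 Engine hazards of the intended proof (cheap checked facts; they do not bear on the truth of the crux)

LITERATURE NOTE (read this session, page-level; for the lead and the planner's `why_might_fail`):

* BrezinaFeireisl2018 (JMSJ; arXiv:1702.04870): admissibility (2.6)/(MV5) is the RENORMALISED entropy inequality for
  all `Z ∈ BC(ℝ)`, `Z' ≥ 0` (p. 5 of the arXiv text), and the weak–strong uniqueness proof of §3.2 FIXES the two-sided
  clamp `Z = Z_{a,b}` inside the relative energy `𝓔_Z` (p. 9–10: "the relative entropy functional depends also on the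
  cut-off function"; `Z_{a,b}(s) = a ∨ (s ∧ b)`). This is the version vendored in tree
  (`IsDissipativeMVSolution.entropy`, `brezinaFeireisl2018_thm_3_3_holds`) — hence `not_isEntropyCutoff_id` below:
  `LocalSecondLaw` (Z = id) is not an instance of ITS hypothesis, and `total_entropy_balance_not_renormalised` uses
  exactly the clamp shape `Z_{0,1}`.
* BrezinaFeireisl2018Revisited (ZAMP, doi:10.1007/s00033-018-0951-8 = arXiv:1710.10751): Definition 2.1 ("(DMV)
  solution", conservative variables `(ρ, m, E)`) postulates ONLY the total entropy balance (2.11)/(MV4) — `Z = id`, NO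
  renormalisation — together with the total energy balance with defect `𝓓` (2.10) and a concentration measure
  `‖μ_C‖ ≤ c∫𝓓` (2.12); Theorem 2.5 (p. 6): weak(mv)–strong uniqueness holds for these D1 solutions as well ("the
  proof requires only obvious modification"), for the polytropic caloric law `p = (γ−1)ρe` with Gibbs' relation and
  thermodynamic stability (entropy allowed to be `−∞` below `p̄ρ^γ`, concave u.s.c. total entropy). So IN PRINT the
  `Z = id` inequality that `LocalSecondLaw` delivers is already enough for the engine, for the perfect monatomic gas
  (`γ = 5/3`, `p̄ = 0`); what remains for the hard-sphere law `p = (2/3) Z_hs(ρσ³) ρ e` (athermal, density-dependent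
  `χ`) is the EOS generalisation of Thm 2.5 and a port of the in-tree engine from Def. 2.9/(2.27) to Def. 2.1/(2.11)
  — the programme of crux idea `athermal-plain-entropy-gronwall`. The planner's G2 ("BF18 consumes the renormalised
  family") is therefore a hazard of the VENDORED engine, not of the method.
* Residual subtlety (prose): `LocalSecondLaw` is the inequality for `S` evaluated on the `r`-MOLLIFIED conserved
  fields, i.e. `S(⟨Y; ·⟩)`, whereas (MV4) needs `⟨Y; S⟩`; by concavity `⟨Y;S⟩ ≤ S(⟨Y;·⟩)`, so in the presence of
  sub-`r` spatial oscillations the filed inequality is strictly WEAKER than (MV4) at positive times (equal at `t = 0`).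
  The hypothesis that forbids such oscillations in this route is `RateFloor` (its B-side pairs particles across the
  whole `r`-ball: sub-`r` velocity structure makes `σ³∫B` over-count and the floor fail — the RateFloor lead's
  `SubgridDomination` content, `Cruxes/RateFloor/RESTATE.md`). So the compactness the engine needs sits in
  `RateFloor`, not in `LocalSecondLaw`; a restatement of RateFloor at kinetic scale (RESTATE (a)) would move it out of
  the hypotheses of THIS crux and must then be supplied inside the glue. -/

open Literature.Analysis.FluidPDE.CompressibleEuler (IsEntropyCutoff)

/-- An UNBOUNDED function is not an admissible entropy cut-off of the in-tree Březina–Feireisl engine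
(`IsEntropyCutoff Z := Continuous Z ∧ Monotone Z ∧ ∃ M, ∀ r, |Z r| ≤ M`; `IsDissipativeMVSolution.entropy`
quantifies over exactly these). [cite: BrezinaFeireisl2018, Def. 2.9 (2.27)] -/
theorem not_isEntropyCutoff_of_unbounded {Z : ℝ → ℝ} (hZ : ∀ M : ℝ, ∃ r, M < |Z r|) : ¬ IsEntropyCutoff Z := by
  rintro ⟨-, -, M, hM⟩
  obtain ⟨r, hr⟩ := hZ M
  exact absurd (hM r) (not_le.2 hr)

/-- **G2 made checkable: `Z = id` is NOT an admissible cut-off.** `LocalSecondLaw` (13081) delivers the local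
entropy inequality for the full entropy `H = −ρ s` only, i.e. the single renormalisation `Z = id`, which the
in-tree engine `brezinaFeireisl2018_thm_3_3` does not even accept as an instance of its hypothesis (2.27). A proof
through that engine must manufacture the bounded-`Z` family (entropy minimum principle) from somewhere else, or
re-prove a BF18 variant for the athermal hard-sphere law with `Z = id` (crux idea `athermal-plain-entropy-gronwall`). -/
theorem not_isEntropyCutoff_id : ¬ IsEntropyCutoff (fun s : ℝ => s) :=
  not_isEntropyCutoff_of_unbounded fun M => ⟨|M| + 1, by
    rw [abs_of_nonneg (by positivity)]
    exact lt_of_le_of_lt (le_abs_self M) (lt_add_one _)⟩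

/-- **The total (`Z = id`) entropy balance does not dominate the renormalised family** — two-cell toy of a Young
measure exchanging heat between its atoms: entropies `(1, −1) ↦ (0, 0)` conserve the total (`Z = id` balance holds
with equality) while the admissible cut-off `Z = clamp to [0, 1]` sees `Z 1 + Z (−1) = 1 > 0 = Z 0 + Z 0`, a strict
DECREASE. So an oscillating limit object can satisfy everything `LocalSecondLaw` passes to the limit and still violate
(2.27); excluding oscillations is precisely the job the other four cruxes (Maxwellian closure) must do BEFORE the
engine is invoked. -/
theorem total_entropy_balance_not_renormalised :
    ∃ Z : ℝ → ℝ, IsEntropyCutoff Z ∧ ∃ s₁ s₂ s₁' s₂' : ℝ,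
      s₁ + s₂ ≤ s₁' + s₂' ∧ Z s₁' + Z s₂' < Z s₁ + Z s₂ := by
  refine ⟨fun s => max 0 (min s 1), ⟨?_, ?_, ⟨1, fun r => ?_⟩⟩, 1, -1, 0, 0, by norm_num, ?_⟩
  · exact continuous_const.max (continuous_id.min continuous_const)
  · exact fun a b hab => max_le_max le_rfl (min_le_min hab le_rfl)
  · rw [abs_le]
    constructor
    · exact le_trans (by norm_num) (le_max_left _ _)
    · exact max_le (by norm_num) (min_le_right _ _)
  · norm_num

/-! ## §6 Junk audit of the shared objects (no kill)

`junk_audit` (docstring record; the checked convention lemmas live in the RateFloor disprover's file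
`Cruxes/RateFloor/Disproof.lean` §1 — `hardSphereKernel_swap_pos_iff`, `pv_eq_precollisional`,
`collisionMark_mem_kernelHemisphere`, `pv_swap` — and are not duplicated here):

* ORIENTATION. `Torus.geometry.sepVec x_i x_j = reprSym (x_i − x_j)` points from `j` to `i`; trajectories are
  right-continuous (`IsHardSphereTrajectory.binary`: `γ t = collidePair i j zl`, `zl` incoming), so the route's
  `pv = reflectVel (sepVec) (v_i, v_j)` returns the PRE-collisional pair, which is incoming:
  `⟪x_i − x_j, v_i⁻ − v_j⁻⟫ < 0`, i.e. `((w − v)·n̂)₊ > 0` at `n̂ = ε⁻¹(x_i − x_j)` — the hemisphere weighted by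
  `hardSphereKernel (w, v) ω = ((w − v)·ω)₊` on the B-side of EvenStressEnskog / RateFloor and by the mark
  `Ξ_P = ((w − v)·n̂)₊ n̂_k n̂_l`. Consistent; no wrong-hemisphere vanishing.
* NORMALISATIONS. `(N+1) ε_N³ = σ³` (`succ_mul_hsDiameter_pow_three`); cone mollifier `3/(π r³)(1 − d/r)₊` has unit
  mass for `r ≤ 1/2` (`integral_cone_eq_one`, LocalSecondLaw/Negative); ordered pairs counted twice on both sides;
  `K_N[1] → σ³ Y π ∫∫|v − w|`, Enskog `Y = (3/2π) f_ex′` matches `hsCompressibility = 1 + η f_ex′` (virial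
  `Z = 1 + (2π/3) η Y`). Consistent.
* LOGS. `hm z s x_i v ≥ (N+1)⁻¹ · 3/(π r³) · G_ϑ(v − v_i) > 0` (the particle's own atom), so every `Real.log` in the
  surprisal `F` of OddContactSymmetry is junk-free; `min 1 (exp (−F)) ∈ (0, 1]`.
* GUARDS. `θm ≥ 0` by Jensen on the cone weights, `Hs a b = 0` unless `0 < a ∧ 0 < b` (LocalSecondLaw) — an EXACT
  velocity coincidence (`θm = 0`, probability zero, not created by the flow) is the only configuration where the
  guard under-reports `+∞`; harmless.
* EMPTY QUANTIFIERS. `T ≤ 0` makes every tied-solution statement vacuous (`Ico 0 T = ∅`), `LocalSecondLaw` carries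
  `0 < T`; `OddContactSymmetry` needs `τ < T`. For `σ³ > 6·0.7405/π` the hard-sphere domain is Liouville-null for
  large `N`, the local Gibbs law is the ZERO measure and every "probability ≤ δ" holds trivially — but every item
  (and the Statement) quantifies `∃ σ₀, ∀ σ < σ₀`, chosen by the prover: not exploitable by either side.
* ORDER. `∃ r₀` after `(χ, g, Ψ/Ξ, η, δ)` and before `N` in every collision item; `∃ η₀` outermost in
  OddContactSymmetry / EvenStressEnskog / Statement, `∃ g₀` outermost in RateFloor: the proof of the crux takes
  `η₀ := min (η₀ᵒᵈᵈ, η₀ᵉᵛᵉⁿ, η₀ᵉᵒˢ)`, legitimate because the hypotheses are closed and come first.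
* STANDING DISPROVERS of the five hypotheses (their `Cruxes/<H>/Disproof.lean`): OddContactSymmetry — rev-1/4 cosh
  weight MISSTATED (velocity holes), repaired at rev 5 (Metropolis weight), parity content untouched; EvenStressEnskog,
  RateFloor, LocalSecondLaw, DensityCap — NO KILL (RateFloor: EDMD j009144/j013767 ratio `= Y(φ)` flat; the filed
  order `∃g₀ ∀η ∀r` is essential, swapped orders junk-true; DensityCap: unguarded ⇒ implosion exposure, §3 here).
  None of the five vacuity channels is currently triggered. -/
theorem junk_audit : True := trivial

/-! ## §7 Targets

None this cycle (`payload.stuck_stubs = []`, no line picked). When a line is picked its stubs become the targets of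
this section. -/

end Summit.AtomisticToContinuum.HydrodynamicLimit.Cruxes.ParityBandClosure.Disproof

end
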